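import Literature.AlgebraicGeometry.HodgeTheory.BettiKunnethPieceHodgeClassesHomIntegerTwist
import Literature.AlgebraicGeometry.HodgeTheory.BettiKunnethPiecesHardLefschetzReduction
import Literature.AlgebraicGeometry.HodgeTheory.KunnethComponentsDiagonalTranspose
import Literature.AlgebraicGeometry.HodgeTheory.BettiKunnethPieceRationalStructure
import HarnessLib

/-!
# The exchange of factors on the window criteria: the Hodge classes of `Hⁱ(Y) ⊗ Hʲ(Z) ⊂ H^{2c}(Y × Z)` have algebraic cross products iff those of `Hʲ(Z) ⊗ Hⁱ(Y) ⊂ H^{2c}(Z × Y)` do; hence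
# `HC(X × X)` ⟺ `HC(X)` and the HALF window `1 ≤ i ≤ j ≤ n`, `i + j = 2c ≥ 4` — per Künneth piece, and per morphism of Hodge structures `φ : H^{2n−j}(X) → Hⁱ(X)(c − n)`
# (Voisin I §11.3.3 Thm. 11.38–11.40, Lemma 11.41, pp. 285–287; §6.2.3 Thm. 6.25; §7.3.1 Def. 7.22; Thm. 11.30; Voisin II Prop. 9.20; Kahn §3.5.3 (3.5.4), Lemma 3.48; Voisin 2025 §3.2.1)

Family `hodge`, lane `lit-hodgefound` (Track 2 foundations library; Layers A1/A4), layer `Literature/AlgebraicGeometry/HodgeTheory`.  THEOREMS ONLY (no definition, no named fact, no instance;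
D-0026 net debt `0`).  The exchange of factors `σ : Y × Z ⥲ Z × Y` is an isomorphism of varieties, so `σ^*` preserves rational classes, Hodge types and algebraic classes (tree `IsoTransport`:
`isRationalClass_map_iff_of_iso`, `isOfHodgeType_map_iff_of_iso`, `mem_algebraicClasses_map_iff_of_iso`) and carries the Künneth piece `Hʲ(Z) ⊗ Hⁱ(Y)` onto `Hⁱ(Y) ⊗ Hʲ(Z)` (Koszul sign; tree
`map_swap_mem_kunnethPiece`); with the rational structure of the pieces (g30: a rational class of `Hⁱ(Y) ⊗ Hʲ(Z) ⊗ ℂ` is `crossMap t ⊗ 1`) the per-piece window condition «`crossMap t ⊗ 1` algebraic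
for every Hodge class `t` of the piece» is SYMMETRIC under `(Y, Z, i, j) ↔ (Z, Y, j, i)` (§1).  For a self-product `X × X` the window `1 ≤ i, j ≤ n` of the tree's assembly
`BettiUniverse.hodgeConjectureFor_tensor_of_kunneth_pieces_pos_le` therefore halves to `i ≤ j` (§2), and — Lemma 11.41 with integer twists (g31-#2) and the faithfulness of the action of a piece
(g30 `BettiUniverse.corrAction_crossMap_injective`) — so does the isolated criterion on morphisms of Hodge structures (§3): `HC(X × X)` ⟺ `HC(X)` and, for `2 ≤ c`, `1 ≤ i ≤ j ≤ n`, `i + j = 2c`,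
every `φ ∈ Hom_HS(H^{2n−j}(X), Hⁱ(X)(c − n))` is induced by some `crossMap t`, `t ∈ Hⁱ(X;ℚ) ⊗ Hʲ(X;ℚ)`, with `crossMap t ⊗ 1` algebraic.

WHAT IS PROVED.
* §1 **`BettiUniverse.forall_crossMap_mem_algebraicClasses_of_swap`**, **`BettiUniverse.forall_crossMap_mem_algebraicClasses_iff_swap`** — the exchange of factors on the per-piece condition.
* §2 **`BettiUniverse.hodgeConjectureFor_tensor_self_iff_forall_kunneth_pieces_le_algebraic`** — given `HC(X)`: `HC(X × X)` ⟺ `crossMap t ⊗ 1` algebraic for every Hodge class `t` of every piece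
  `Hⁱ(X) ⊗ Hʲ(X)` with `1 ≤ i ≤ j ≤ n`, `i + j = 2c`, `2 ≤ c`.
* §3 (complex orientations) **`BettiUniverse.hodgeConjectureFor_tensor_self_iff_forall_hom_le_exists_crossMap_algebraic`** — given `HC(X)`: `HC(X × X)` ⟺ for `2 ≤ c`, `1 ≤ i ≤ j ≤ n`, `i + j = 2c`,
  `a + j = 2n`, `n + r = c`, every `φ : Hᵃ(X) → Hⁱ(X)(r)` is induced on `Hᵃ(X;ℂ)` by some `crossMap t` with `crossMap t ⊗ 1` algebraic.

THE PRINTS.  C. Voisin (2002) [VoisinHodgeI2002] §6.2.3 Thm. 6.25, Rem. 6.27; §7.3.1 Def. 7.22, Lemma 7.23; §7.3.2; §11.3.1 Thm. 11.30; §11.3.3 Thm. 11.38–11.40, Lemma 11.41 and pp. 285–287.  C. Voisin (2003)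
[VoisinHodgeII2003] §9.2.4 Prop. 9.20.  B. Kahn (2020) [Kahn2020] §3.5.3 (3.5.4), Lemma 3.48.  C. Voisin (2025) [Voisin2025] §3.2.1 (12)–(14), Prop. 3.8, Cor. 3.9.  A. Grothendieck (1969) [GrothendieckTopology1969] §1.
P. Deligne (2000/2006) [Deligne2000] §1.

THE OBJECTS (all the tree's).  `BettiUniverse.kunnethSummand`, `BettiUniverse.crossMap`, `kunnethPiece`, `BettiUniverse.hodge`, `corrAction complexOrientationFamily`, `HodgeStructure.Hom`, `tateTwist` (`r : ℤ`),
`cast`, `hodgeClasses`, `ofRatClass`, `algebraicClasses`, `IsRationalClass`, `IsOfHodgeType`, `HodgeConjectureFor`, the exchange `lift (snd Y Z) (fst Y Z) : Y ⊗ Z ⟶ Z ⊗ Y`; the tree's `swap_comp_swap`,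
`map_swap_mem_kunnethPiece`, `isRationalClass_map_iff_of_iso`, `isOfHodgeType_map_iff_of_iso`, `mem_algebraicClasses_map_iff_of_iso`, `ofRatClass_crossMap_mem_kunnethPiece`,
`BettiUniverse.exists_eq_ofRatClass_crossMap_of_isRationalClass`, `BettiUniverse.mem_hodgeClasses_kunnethSummand_iff_crossMap_mem`, `BettiUniverse.mem_hodgeClasses_hodge_iff_isOfHodgeType`,
`BettiUniverse.hodgeConjectureFor_tensor_of_kunneth_pieces_pos_le`, `BettiUniverse.crossMap_mem_hodgeClasses`, g31-#2 `BettiUniverse.exists_hom_tateTwist_int_of_mem_hodgeClasses_kunnethSummand`,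
`BettiUniverse.exists_mem_hodgeClasses_corrAction_crossMap_eq_ofRatClass_hom_int`, g30 `BettiUniverse.corrAction_crossMap_injective`, `BettiUniverse.span_range_ofRatClass_eq_top`.

DEVIATIONS / SCOPE.  §1–§2 for the Betti universe's rational Künneth summands of `H^{2c}` (even total degree, weight `c`), any pair `Y`, `Z` with `Y ⊗ Z`, `Z ⊗ Y` of the same dimension `d`; §3 complex
orientations.  No definitions.

## References
* [VoisinHodgeI2002] C. Voisin, *Hodge Theory and Complex Algebraic Geometry I* (2002) — §6.2.3 Thm. 6.25, Rem. 6.27; §7.3.1 Def. 7.22, Lemma 7.23; §7.3.2; §11.3.1 Thm. 11.30; §11.3.3 Thm. 11.38–11.40, Lemma 11.41, pp. 285–287.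
* [VoisinHodgeII2003] C. Voisin, *Hodge Theory and Complex Algebraic Geometry II* (2003) — §9.2.4 Prop. 9.20.
* [Kahn2020] B. Kahn, *Zeta and L-functions of varieties and motives* (2020) — §3.5.3 (3.5.4), Lemma 3.48.
* [Voisin2025] C. Voisin, *Cycle classes on algebraic varieties* (2025) — §3.2.1 (12)–(14), Prop. 3.8, Cor. 3.9.
* [GrothendieckTopology1969] A. Grothendieck, *Hodge's general conjecture is false for trivial reasons* (1969) — §1.
* [Deligne2000] P. Deligne, *The Hodge conjecture* (Clay problem description) — §1.

## Provenance
Lane `lit-hodgefound` (Hodge path, Track 2), prover seat `lit-hodgefound-p29` (generation 31), self-proposed row g31-#12 (the exchange of factors on the window criteria; the half window for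
self-products).
-/

noncomputable section

open scoped TensorProduct
open CategoryTheory MonoidalCategory CartesianMonoidalCategory Module Finset
open Literature.AlgebraicTopology.SingularHomology
open Literature.Geometry.Kaehler

namespace Literature.AlgebraicGeometry.HodgeTheory

open Literature.AlgebraicGeometry.Motives
open Literature.AlgebraicGeometry.Motives.HodgeStructure

variable {m n d : ℕ} {X Y Z : SchemeOver ℂ}

variable [HodgeTensorFacts.{0, 0}]

/-! ### §1 The exchange of factors on the per-piece condition -/

/-- **If every Hodge class `t` of the piece `Hⁱ(Y) ⊗ Hʲ(Z) ⊂ H^{2c}(Y × Z)` has `crossMap t ⊗ 1` algebraic, then so does every Hodge class `u` of the piece `Hʲ(Z) ⊗ Hⁱ(Y) ⊂ H^{2c}(Z × Y)`**: with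
`σ : Y × Z ⥲ Z × Y` the exchange of factors, `σ^*(crossMap u ⊗ 1)` is a rational class of Hodge type `(c, c)` in the piece `Hⁱ(Y) ⊗ Hʲ(Z) ⊗ ℂ` (Koszul sign rule), hence `= crossMap t ⊗ 1` for a Hodge
class `t` of that piece — algebraic — and `σ` is an isomorphism. [cite: Kahn2020, §3.5.3 (3.5.4) and Lemma 3.48] [cite: VoisinHodgeI2002, §11.3.3 Thm. 11.38–11.40 and p. 285, §7.1.1] [cite: GrothendieckTopology1969, §1] -/
theorem BettiUniverse.forall_crossMap_mem_algebraicClasses_of_swap (hHD : exists_isReal_hodgeModel) (hY : IsSmoothProjective m Y) (hZ : IsSmoothProjective n Z) (hYZ : IsSmoothProjective d (Y ⊗ Z))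
    (hZY : IsSmoothProjective d (Z ⊗ Y)) {i j c : ℕ} (hij : i + j = 2 * c) (hji : j + i = 2 * c)
    (h : ∀ t ∈ (BettiUniverse.kunnethSummand hHD hY hZ (2 * c) ⟨(i, j), HasAntidiagonal.mem_antidiagonal.2 hij⟩).hodgeClasses c,
      ofRatClass (ComplexPoints (Y ⊗ Z)) (2 * c) (BettiUniverse.crossMap Y Z hij t) ∈ algebraicClasses (Y ⊗ Z) c) :
    ∀ u ∈ (BettiUniverse.kunnethSummand hHD hZ hY (2 * c) ⟨(j, i), HasAntidiagonal.mem_antidiagonal.2 hji⟩).hodgeClasses c,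
      ofRatClass (ComplexPoints (Z ⊗ Y)) (2 * c) (BettiUniverse.crossMap Z Y hji u) ∈ algebraicClasses (Z ⊗ Y) c := by
  intro u hu
  -- the exchange of factors `σ : Y ⊗ Z ≅ Z ⊗ Y`
  let e : Y ⊗ Z ≅ Z ⊗ Y := ⟨lift (snd Y Z) (fst Y Z), lift (snd Z Y) (fst Z Y), swap_comp_swap Y Z, swap_comp_swap Z Y⟩
  -- `σ^*(crossMap u ⊗ 1)` lies in the piece `(i, j)` of `Y × Z` and is rational: it is some `crossMap t ⊗ 1`
  have hmem : complexBetti.map e.hom (2 * c) (ofRatClass (ComplexPoints (Z ⊗ Y)) (2 * c) (BettiUniverse.crossMap Z Y hji u)) ∈ kunnethPiece Y Z hij :=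
    map_swap_mem_kunnethPiece (ofRatClass_crossMap_mem_kunnethPiece hji u) hij rfl rfl
  have hrat : IsRationalClass (complexBetti.map e.hom (2 * c) (ofRatClass (ComplexPoints (Z ⊗ Y)) (2 * c) (BettiUniverse.crossMap Z Y hji u))) :=
    (isRationalClass_map_iff_of_iso e).2 (isRationalClass_ofRatClass _)
  obtain ⟨t, ht⟩ := BettiUniverse.exists_eq_ofRatClass_crossMap_of_isRationalClass hY hZ hij hmem hrat
  -- `t` is a Hodge class of the piece (Hodge types transport along `σ`)
  have htH : t ∈ (BettiUniverse.kunnethSummand hHD hY hZ (2 * c) ⟨(i, j), HasAntidiagonal.mem_antidiagonal.2 hij⟩).hodgeClasses c := by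
    rw [BettiUniverse.mem_hodgeClasses_kunnethSummand_iff_crossMap_mem hHD hY hZ hYZ hij c t, BettiUniverse.mem_hodgeClasses_hodge_iff_isOfHodgeType hHD hYZ c, ← ht,
      isOfHodgeType_map_iff_of_iso e, ← BettiUniverse.mem_hodgeClasses_hodge_iff_isOfHodgeType hHD hZY c, ← BettiUniverse.mem_hodgeClasses_kunnethSummand_iff_crossMap_mem hHD hZ hY hZY hji c u]
    exact hu
  -- so `σ^*(crossMap u ⊗ 1) = crossMap t ⊗ 1` is algebraic, and `σ` is an isomorphism
  have halg := h t htH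
  rw [← ht, mem_algebraicClasses_map_iff_of_iso e] at halg
  exact halg

/-- **The per-piece condition is symmetric under the exchange of factors**: the Hodge classes of `Hⁱ(Y) ⊗ Hʲ(Z) ⊂ H^{2c}(Y × Z)` have algebraic cross products iff those of `Hʲ(Z) ⊗ Hⁱ(Y) ⊂ H^{2c}(Z × Y)` do.
[cite: Kahn2020, §3.5.3 (3.5.4) and Lemma 3.48] [cite: VoisinHodgeI2002, §11.3.3 Thm. 11.38–11.40 and p. 285] [cite: GrothendieckTopology1969, §1] -/
theorem BettiUniverse.forall_crossMap_mem_algebraicClasses_iff_swap (hHD : exists_isReal_hodgeModel) (hY : IsSmoothProjective m Y) (hZ : IsSmoothProjective n Z) (hYZ : IsSmoothProjective d (Y ⊗ Z))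
    (hZY : IsSmoothProjective d (Z ⊗ Y)) {i j c : ℕ} (hij : i + j = 2 * c) (hji : j + i = 2 * c) :
    (∀ t ∈ (BettiUniverse.kunnethSummand hHD hY hZ (2 * c) ⟨(i, j), HasAntidiagonal.mem_antidiagonal.2 hij⟩).hodgeClasses c,
        ofRatClass (ComplexPoints (Y ⊗ Z)) (2 * c) (BettiUniverse.crossMap Y Z hij t) ∈ algebraicClasses (Y ⊗ Z) c) ↔
      ∀ u ∈ (BettiUniverse.kunnethSummand hHD hZ hY (2 * c) ⟨(j, i), HasAntidiagonal.mem_antidiagonal.2 hji⟩).hodgeClasses c,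
        ofRatClass (ComplexPoints (Z ⊗ Y)) (2 * c) (BettiUniverse.crossMap Z Y hji u) ∈ algebraicClasses (Z ⊗ Y) c :=
  ⟨BettiUniverse.forall_crossMap_mem_algebraicClasses_of_swap hHD hY hZ hYZ hZY hij hji, BettiUniverse.forall_crossMap_mem_algebraicClasses_of_swap hHD hZ hY hZY hYZ hji hij⟩

/-! ### §2 Self-products: the half window `i ≤ j`, per piece -/

/-- **Given `HC(X)`: `HC(X × X)` ⟺ for every piece `Hⁱ(X) ⊗ Hʲ(X) ⊂ H^{2c}(X × X)` with `1 ≤ i ≤ j ≤ n`, `i + j = 2c`, `2 ≤ c`, and every Hodge class `t` of it, `crossMap t ⊗ 1` is algebraic** (the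
tree's assembly `…_of_kunneth_pieces_pos_le` over the window `1 ≤ i, j ≤ n`, the pieces with `i > j` by the exchange of factors, §1; «⇒»: `crossMap t` is a Hodge class of `H^{2c}(X × X)`, Thm. 11.40).
[cite: VoisinHodgeI2002, §11.3.3 Thm. 11.38, Thm. 11.40, Lemma 11.41, p. 287, §11.3.1 Thm. 11.30, §6.2.3 Thm. 6.25] [cite: Kahn2020, §3.5.3 (3.5.4) and Lemma 3.48] [cite: VoisinHodgeII2003, §9.2.4 Prop. 9.20] [cite: Deligne2000, §1] -/
theorem BettiUniverse.hodgeConjectureFor_tensor_self_iff_forall_kunneth_pieces_le_algebraic (hHD : exists_isReal_hodgeModel) (hX : IsSmoothProjective n X) (hXX : IsSmoothProjective d (X ⊗ X))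
    (hHCX : HodgeConjectureFor n X) :
    HodgeConjectureFor d (X ⊗ X) ↔
      ∀ (c i j : ℕ) (hij : i + j = 2 * c), 1 ≤ i → i ≤ j → j ≤ n → 2 ≤ c →
        ∀ t ∈ (BettiUniverse.kunnethSummand hHD hX hX (2 * c) ⟨(i, j), HasAntidiagonal.mem_antidiagonal.2 hij⟩).hodgeClasses c,
          ofRatClass (ComplexPoints (X ⊗ X)) (2 * c) (BettiUniverse.crossMap X X hij t) ∈ algebraicClasses (X ⊗ X) c := by
  refine ⟨fun hHC c i j hij _ _ _ _ t ht ↦ ?_, fun h ↦ BettiUniverse.hodgeConjectureFor_tensor_of_kunneth_pieces_pos_le hHD hX hX hXX hHCX hHCX fun c i j hij hi him hj hjn hc t ht ↦ ?_⟩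
  · exact hHC.2 c _ (isRationalClass_ofRatClass _) ((BettiUniverse.mem_hodgeClasses_hodge_iff_isOfHodgeType hHD hXX c _).1
      (BettiUniverse.crossMap_mem_hodgeClasses hHD hodgePQ_independent_of_hodgeModel_holds hX hX hXX hij c ht))
  · by_cases hle : i ≤ j
    · exact h c i j hij hi hle hjn hc t ht
    · -- `i > j`: the exchange of factors brings the piece `(j, i)`, `j ≤ i`
      exact BettiUniverse.forall_crossMap_mem_algebraicClasses_of_swap hHD hX hX hXX hXX (show j + i = 2 * c by omega) hij (h c j i (by omega) hj (by omega) him hc) t ht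

/-! ### §3 Self-products: the half window `i ≤ j`, per morphism of Hodge structures -/

/-- **Given `HC(X)`: `HC(X × X)` ⟺ for `2 ≤ c`, `1 ≤ i ≤ j ≤ n`, `i + j = 2c`, `a + j = 2n`, `n + r = c`, every morphism of `ℚ`-Hodge structures `φ : Hᵃ(X) → Hⁱ(X)(r)` is induced on `Hᵃ(X;ℂ)` by some
`crossMap t`, `t ∈ Hⁱ(X;ℚ) ⊗ Hʲ(X;ℚ)`, with `crossMap t ⊗ 1` algebraic** (complex orientations; §2 and Lemma 11.41 with integer twists: «⇒» `t = t_φ`; «⇐» the class provided for `φ_u` acts as the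
Hodge class `u` does, so equals `u` by the faithfulness of the action of a piece). [cite: VoisinHodgeI2002, §7.3.1 Def. 7.22, §7.3.2, §11.3.3 Thm. 11.38–11.40, Lemma 11.41 and pp. 285–287, §6.2.3 Thm. 6.25, §11.3.1 Thm. 11.30]
[cite: Kahn2020, §3.5.3 (3.5.4) and Lemma 3.48] [cite: Voisin2025, §3.2.1 (12)–(14), Prop. 3.8 and Cor. 3.9] [cite: Deligne2000, §1] -/
theorem BettiUniverse.hodgeConjectureFor_tensor_self_iff_forall_hom_le_exists_crossMap_algebraic (hHD : exists_isReal_hodgeModel) (hX : IsSmoothProjective n X)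
    (hXX : IsSmoothProjective d (X ⊗ X)) (hHCX : HodgeConjectureFor n X) :
    HodgeConjectureFor d (X ⊗ X) ↔
      ∀ (c i j a : ℕ) (r : ℤ) (_hc : 2 ≤ c) (_hi : 1 ≤ i) (_hle : i ≤ j) (_hjn : j ≤ n) (hij : i + j = 2 * c) (_haj : a + j = 2 * n) (hab : a + 2 * c = i + 2 * n)
        (_hr : ((n : ℕ) : ℤ) + r = ((c : ℕ) : ℤ)) (hw : ((i : ℕ) : ℤ) - 2 * r = ((a : ℕ) : ℤ))
        (φ : HodgeStructure.Hom (BettiUniverse.hodge hHD hX a) (((BettiUniverse.hodge hHD hX i).tateTwist r).cast hw)),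
        ∃ t : bettiCohomology X i ⊗[ℚ] bettiCohomology X j, ofRatClass (ComplexPoints (X ⊗ X)) (2 * c) (BettiUniverse.crossMap X X hij t) ∈ algebraicClasses (X ⊗ X) c ∧
          ∀ v, corrAction complexOrientationFamily hX hX hab (ofRatClass (ComplexPoints (X ⊗ X)) (2 * c) (BettiUniverse.crossMap X X hij t)) (ofRatClass (ComplexPoints X) a v) =
            ofRatClass (ComplexPoints X) i (φ.toLinearMap v) := by
  rw [BettiUniverse.hodgeConjectureFor_tensor_self_iff_forall_kunneth_pieces_le_algebraic hHD hX hXX hHCX]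
  constructor
  · intro h c i j a r hc hi hle hjn hij haj hab hr hw φ
    obtain ⟨t, ht, hφ⟩ := BettiUniverse.exists_mem_hodgeClasses_corrAction_crossMap_eq_ofRatClass_hom_int hHD hX hX hij haj hab hr hw φ
    exact ⟨t, h c i j hij hi hle hjn hc t ht, hφ⟩
  · intro h c i j hij hi hle hjn hc u hu
    have haj : (2 * n - j) + j = 2 * n := by omega
    have hab : (2 * n - j) + 2 * c = i + 2 * n := by omega
    have hr : ((n : ℕ) : ℤ) + (((c : ℕ) : ℤ) - ((n : ℕ) : ℤ)) = ((c : ℕ) : ℤ) := by omega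
    have hw : ((i : ℕ) : ℤ) - 2 * (((c : ℕ) : ℤ) - ((n : ℕ) : ℤ)) = (((2 * n - j : ℕ)) : ℤ) := by omega
    -- the morphism `φ_u` of the Hodge class `u` and the class `t` the criterion provides for it
    obtain ⟨φ, hφ⟩ := BettiUniverse.exists_hom_tateTwist_int_of_mem_hodgeClasses_kunnethSummand hHD hX hX hij hab hr hw hu
    obtain ⟨t, ht, htφ⟩ := h c i j (2 * n - j) (((c : ℕ) : ℤ) - ((n : ℕ) : ℤ)) hc hi hle hjn hij haj hab hr hw φ
    -- `t` and `u` act alike on `H^{2n−j}(X;ℂ)`, hence `t = u`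
    have e : t = u := BettiUniverse.corrAction_crossMap_injective complexOrientationFamily hX hX hij haj hab
      (LinearMap.ext_on_range (BettiUniverse.span_range_ofRatClass_eq_top hX (2 * n - j)) fun v ↦ by rw [htφ v, hφ v])
    exact e ▸ ht

end Literature.AlgebraicGeometry.HodgeTheory

end
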